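import Summits.HodgeConjecture.HodgeConjecture.Theorems.R90S9InnerFormSec146Data      -- ★ ed. 1 (p01): `InnerFormSec146.Place`, `S0`
import HarnessLib

/-!
# R90-TF · S9 «InnerForm-13.3.6 (c)» — the compact places of a FRAMED hermitian form: every complex place `w ≠ w(ι)` lies in `S₀` (dictionary row D3 of
# `CENSUS-d4prime.p02.md`: the letter PIN-τ quantifies «`∀ τ, mk τ ≠ mk ι`», the carpet `Γ₀^{sph}` quantifies «`∀ v ∈ Γ.S₀`»)

Cell `hodgecm-mathlib`, crux H413 (`stmt-HodgeConjecture-24833`), route of record `HCCMUnconditional`; programme R90-TF, section S9 (base `R90-IF`), seat R90-IF-p02 (g0), deal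
(d4′) of R90-IF-plan (g2) 2026-09-04T22:54:17Z (10).  Helper file, lane `--supports stmt-HodgeConjecture-24833 --as helper`; theorems only (no definition, no instance,
no notation, no named fact, no `sorry`).  HONEST LABEL: HC_CM is proved only modulo the 7 printed citations (2 remaining named inputs: hLiu418 = stmt-HodgeConjecture-24832,
h413 = stmt-HodgeConjecture-24833) until rung 0 closes; bookkeeping on places, no digit moves.

* `inr_mem_s0_of_posDef` — a complex place at which `H` is positive definite is in `S₀`.
* `inr_mk_mem_s0_of_frame (hdef)` — under the frame hypothesis `hdef : ∀ τ′, mk τ′ ≠ mk ι → (H^{τ′}) ≻ 0`, EVERY `τ` off the place of `ι` gives `inr (mk τ) ∈ S0 L H`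
  (Mathlib `NumberField.InfinitePlace.mk_embedding`: `mk (mk τ).embedding = mk τ`).
* `inr_mem_s0_of_frame (hdef)` — the same for a place `w ≠ mk ι`.
[cite: Rogawski1990, §14.2 p. 232 (`S₀` = the places with `G′_w ≅ U₃(ℝ)`); §14.6 p. 244]
-/

set_option autoImplicit false
-- the mandated namespace repeats `HodgeConjecture.HodgeConjecture`, as in every `Theorems/*.lean` of this sub-problem
set_option linter.dupNamespace false

noncomputable section

open NumberField
open scoped Matrix ComplexOrder

namespace Summit.HodgeConjecture.HodgeConjecture.R90.S9.InnerFormSec146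

variable (L : Type) [Field L] (H : Matrix (Fin 3) (Fin 3) L)

/-- **A complex place at which `H` is positive definite lies in `S₀`** (unfolding ★ `S0`). [cite: Rogawski1990, §14.2 p. 232] -/
theorem inr_mem_s0_of_posDef (w : InfinitePlace L) (hw : (H.map w.embedding).PosDef) : (Sum.inr w : Place L) ∈ S0 L H :=
  ⟨w, rfl, Or.inl hw⟩

/-- **Under the frame hypothesis, every embedding `τ` off the place of `ι` gives a compact place `inr (mk τ) ∈ S₀`**: `hdef` at the distinguished embedding
`(mk τ).embedding` of the place of `τ` (Mathlib `InfinitePlace.mk_embedding`). [cite: Rogawski1990, §14.2 p. 232; §14.6 p. 244] -/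
theorem inr_mk_mem_s0_of_frame (ι : L →+* ℂ) (hdef : ∀ τ' : L →+* ℂ, InfinitePlace.mk τ' ≠ InfinitePlace.mk ι → (H.map τ').PosDef)
    (τ : L →+* ℂ) (hτ : InfinitePlace.mk τ ≠ InfinitePlace.mk ι) :
    (Sum.inr (InfinitePlace.mk τ) : Place L) ∈ S0 L H :=
  inr_mem_s0_of_posDef L H (InfinitePlace.mk τ) (hdef _ (by rwa [InfinitePlace.mk_embedding]))

/-- **Under the frame hypothesis, every complex place `w ≠ w(ι)` is in `S₀`.** [cite: Rogawski1990, §14.2 p. 232; §14.6 p. 244] -/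
theorem inr_mem_s0_of_frame (ι : L →+* ℂ) (hdef : ∀ τ' : L →+* ℂ, InfinitePlace.mk τ' ≠ InfinitePlace.mk ι → (H.map τ').PosDef)
    (w : InfinitePlace L) (hw : w ≠ InfinitePlace.mk ι) : (Sum.inr w : Place L) ∈ S0 L H :=
  inr_mem_s0_of_posDef L H w (hdef _ (by rwa [InfinitePlace.mk_embedding]))

end Summit.HodgeConjecture.HodgeConjecture.R90.S9.InnerFormSec146

end
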